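import Summits.HubbardSuperconductivity.HubbardSuperconductivity.Theorems.NodalWardXYPerturbedXYOrderReduction
import Summits.HubbardSuperconductivity.HubbardSuperconductivity.Theorems.NodalWardXYPerturbedXYOrderReflectionOdd
import Summits.HubbardSuperconductivity.HubbardSuperconductivity.Theorems.NodalWardXYPerturbedXYOrderOddKernelExample

/-!
# `PerturbedXYOrder` (stmt-HubbardSuperconductivity-10739) — line `schwarz-inheritance`, stubs `stub_oddKernelSign`,
# `stub_oddKernelExampleSign` (lead c5 compositions)

**Zero-freeness is a SIGN on the reflection-odd class.**  Let `R : x ↦ (−x₀, x₁, x₂)` be the torus reflection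
(`Function.update x 0 (-x 0)`), acting on angle configurations by `θ ↦ θ ∘ R`.  For a purely imaginary kernel `K` whose
perturbation `W_K` is odd under `θ ↦ θ ∘ R`, the partition function `Z_K` is REAL (`stub_reflectionOddReal`, landed in
`…ReflectionOdd.lean`): `Z_K / Z_0 = E_J cos(Im W_K)`.  Along the segment `s ↦ sK`, `s ∈ [0,1]`, the class and admissibility
are preserved, `s ↦ Re Z_{sK}` is continuous (`stub_entire`) and equals `Z_0 > 0` at `s = 0`; so IF the crux holds (no zero on
the segment) the intermediate value theorem forces `Re Z_K > 0` (`stub_oddKernelSign`).  `stub_oddKernelExampleSign` specialises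
this to the admissible local mixed-direction kernel `K₀((x,0),(x',1)) = i(δ_{x',x} + δ_{x',x+e₀})` of `stub_oddKernelExample`
(landed in `…OddKernelExample.lean`): under the crux, `E_J cos(εt Σ_x j_{(x,0)}(j_{(x,1)} + j_{(x+e₀,1)})) > 0` for all
`J ≥ J₀`, `L ≥ 2`, `|t| ≤ 1/16`.  Refuter-facing contrapositive: ONE certified negative value of this real Gibbs expectation at
some `J ≥ J₀`, `L ≥ 2`, `|t| ≤ 1/16` refutes the crux at radius `ε` — a sign replaces the search for a complex zero of an
`L³`-dimensional oscillatory integral (Disproof.lean §5.2).  No new mathematics beyond the two landed stubs, `stub_entire` and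
`sch_admissible_smul`; this file is the registered composition.
-/

noncomputable section

namespace Summit.HubbardSuperconductivity.HubbardSuperconductivity.Theorems.PerturbedXYOrder

open MeasureTheory Literature.Probability.LatticeModels
open Summit.HubbardSuperconductivity.HubbardSuperconductivity.Theses.NodalWardXY

/-- **Crux ⇒ positivity of the real partition function on the reflection-odd imaginary class.** If `PerturbedXYOrder`
holds with data `J₀, ε`, then for `J ≥ J₀`, `L ≥ 2` and every admissible, purely imaginary kernel `K` with `W_K` odd under
`θ ↦ θ ∘ R`, `R x = (−x₀, x₁, x₂)`, the real number `Z_K` is positive: `s ↦ Re Z_{sK}` is continuous on `[0,1]` (`stub_entire`),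
vanishes nowhere (the crux at `sK`, which is admissible, imaginary and odd, plus `stub_reflectionOddReal`), and equals `Z_0 > 0`
at `s = 0`; conclude by the intermediate value theorem. -/
theorem stub_oddKernelSign :
    PerturbedXYOrder → ∃ J₀ ε : ℝ, 0 < ε ∧ ∀ J : ℝ, J₀ ≤ J → ∀ (L : ℕ) [NeZero L], 2 ≤ L → ∀ K : Bond L → Bond L → ℂ,
      Admissible L ε K → (∀ b b', (K b b').re = 0) →
      (∀ θ : TorusSite 3 L → ℝ, Wk K (fun x => θ (Function.update x 0 (-x 0))) = -Wk K θ) →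
      0 < (Zk J K).re := by
  intro h
  rw [perturbedXYOrder_iff] at h
  obtain ⟨J₀, ε, a, hε, -, h⟩ := h
  refine ⟨J₀, ε, hε, fun J hJ L _ hL K hK hIm hOdd => ?_⟩
  -- the real path `s ↦ Re Z_{sK}`
  set f : ℝ → ℝ := fun s => (Zk J (((s : ℝ) : ℂ) • K)).re with hf
  have hcont : Continuous f :=
    Complex.continuous_re.comp ((stub_entire J L K).1.continuous.comp Complex.continuous_ofReal)
  have hne : ∀ s ∈ Set.Icc (0:ℝ) 1, f s ≠ 0 := by
    intro s hs hfs
    have hadm : Admissible L ε (((s : ℝ) : ℂ) • K) := by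
      refine sch_admissible_smul ?_ hK
      rw [Complex.norm_real, Real.norm_eq_abs, abs_of_nonneg hs.1]
      exact mul_le_of_le_one_left hε.le hs.2
    have hZ := (h J hJ L hL _ hadm).1
    have hIm' : ∀ b b', ((((s : ℝ) : ℂ) • K) b b').re = 0 := by
      intro b b'
      simp [Complex.mul_re, hIm b b']
    have hOdd' : ∀ θ : TorusSite 3 L → ℝ,
        Wk (((s : ℝ) : ℂ) • K) (fun x => θ (Function.update x 0 (-x 0))) = -Wk (((s : ℝ) : ℂ) • K) θ := by
      intro θ
      rw [ent_Wk_smul, ent_Wk_smul, hOdd, mul_neg]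
    have him := (stub_reflectionOddReal L J _ hIm' hOdd').1
    exact hZ (Complex.ext (by simpa [hf] using hfs) (by simpa using him))
  have h0 : 0 < f 0 := by
    have : f 0 = (Zk J (0 : Bond L → Bond L → ℂ)).re := by simp [hf]
    rw [this, even_Zk_zero_eq, Complex.ofReal_re]
    exact integral_xyWeight_pos J
  have h1 : f 1 = (Zk J K).re := by simp [hf]
  rw [← h1]
  by_contra hneg
  obtain ⟨s, hs, hfs⟩ := intermediate_value_Icc' zero_le_one hcont.continuousOn ⟨le_of_not_gt hneg, h0.le⟩
  exact hne s hs hfs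

/-- **The refuter-facing real target, made explicit.** Under the crux (data `J₀, ε`), for `J ≥ J₀`, `L ≥ 2` and `|t| ≤ 1/16`
the real number `Z_{εt K₀} = Z_0 · E_J cos(εt Σ_x j_{(x,0)}(j_{(x,1)} + j_{(x+e₀,1)}))` is positive, `K₀` being the admissible local
mixed-direction kernel of `stub_oddKernelExample` (odd under `θ ↦ θ ∘ R`). -/
theorem stub_oddKernelExampleSign :
    PerturbedXYOrder → ∃ J₀ ε : ℝ, 0 < ε ∧ ∀ J : ℝ, J₀ ≤ J → ∀ (L : ℕ) [NeZero L], 2 ≤ L → ∀ t : ℝ, |t| ≤ 1 / 16 →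
      0 < (Zk J (fun b b' : Bond L =>
        ((ε * t : ℝ) : ℂ) *
          (if b.2 = 0 ∧ b'.2 = 1 ∧ (b'.1 = b.1 ∨ b'.1 = b.1 + Pi.single 0 1) then Complex.I else 0))).re := by
  intro h
  obtain ⟨J₀, ε, hε, hpos⟩ := stub_oddKernelSign h
  refine ⟨J₀, ε, hε, fun J hJ L _ hL t ht => ?_⟩
  obtain ⟨hodd, hadm⟩ := stub_oddKernelExample L
  set K₀ : Bond L → Bond L → ℂ := fun b b' =>
    if b.2 = 0 ∧ b'.2 = 1 ∧ (b'.1 = b.1 ∨ b'.1 = b.1 + Pi.single 0 1) then Complex.I else 0 with hK₀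
  have hsmul : (fun b b' : Bond L => ((ε * t : ℝ) : ℂ) * K₀ b b') = (((ε * t : ℝ) : ℂ) • K₀) := by
    funext b b'; rfl
  refine hpos J hJ L hL _ (hadm ε t hε.le ht) (fun b b' => ?_) (fun θ => ?_)
  · by_cases hb : b.2 = 0 ∧ b'.2 = 1 ∧ (b'.1 = b.1 ∨ b'.1 = b.1 + Pi.single 0 1)
    · simp [hb]
    · simp [hb]
  · show Wk (fun b b' : Bond L => ((ε * t : ℝ) : ℂ) * K₀ b b') _ = -Wk (fun b b' : Bond L => ((ε * t : ℝ) : ℂ) * K₀ b b') θ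
    rw [hsmul, ent_Wk_smul, ent_Wk_smul, hodd θ, mul_neg]

end Summit.HubbardSuperconductivity.HubbardSuperconductivity.Theorems.PerturbedXYOrder

end
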